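import Literature.MathematicalPhysics.QuantumFieldTheory.Balaban1983to89.B13EntrywiseBlockRungWitness

/-!
# `Balaban1983to89.B13EntrywiseBlockRungExchangeWitness` — (B′) PLUS PRINT's TWO EXCHANGE THRESHOLDS: the entrywise NODE-A
# block, the reference-rung block AND `hαsmall` («bigger analyticity space», p. 15), `hRσlarge` («σ-cubes far from Z₀», (1.11)
# p. 5) of the N10 junction ([Balaban1988RG2Cluster] Lemmas 1–3, forms 32 ∕ 51C) AT ONE ADMISSIBLE REFERENCE PACKAGE, for EVERY
# exchange letter `θ₀ > 0` — the circularity-sensitive pair closed in the order «`K̄, μ, κ_C⋆` (radius-free) → `R₁` → `R_σ` → `R`»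

statement-level bookkeeping over published theorems with citation tags; finite-matrix MODELS on a site torus and one explicit
constants package, kernel-checked; nothing here is a claim about the Yang–Mills mass gap.

Cell `pub-ymgap`, D-0062 Track A (HUMAN RULING D-0149 width push), node N10 = [Balaban1988RG2Cluster] Lemmas 1–3; seat
`pub-ymgap-dag-n10-w2` g0 (width seat 2), successor item (B″) of (B) `B13EntrywiseBlockWitness` (p583593) and (B′)
`B13EntrywiseBlockRungWitness` (p586283).

WHY.  (B′) inhabits, at ONE admissible `RefPackage`, the NODE-A block and the rung binders `hrf hR₁ hR₁R hPσ hP₁ hAσ hA₁ hp hη hαR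
hεL hκL hKL hεA hκA hKA hmA hKG hKCs` of module 32 `…N10AtRecord11B13WalksBlockEntrywise.b13LeafOfRecord_of_located_entrywise`.  Two
more binders of the same (3)-group read the SAME package and are the ones whose joint satisfiability is not automatic (cf.
`B13NodeTorusWalksRungWitness`, header): `hαsmall : α ≤ θ₀·R₁∕(4K̄ + 4)` and `hRσlarge : log((4K̄ + 4)∕θ₀)∕(μ∕4 − κ_C⋆) ≤ rf.R_σ`,
`K̄ = (rf.toWalkPackage R₁).Kbar`, `μ = (…).mu`, `κ_C⋆ = (…).kapCStar` ([Balaban1988RG2Cluster] p. 15: the analyticity space with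
`α′₀, α′₁`; (1.11) p. 5, p. 13: «dist(X, Z₀) > ⅔M»).  They couple the accretivity radius `R₁` and the far-ness `R_σ` to the
package's exchange constant and rates — but `Kbar`, `mu`, `kapCStar` (like `etaMax`) read NEITHER `R` NOR `R_σ` NOR `R₁` (`rfl`,
§2), so with the exchange letter `θ₀ > 0` an INPUT the order of choices «rates, `K̄_P = K̄_A = K̄_L`, `m₀ = m_{A,0} = M`, `η := etaMax`
(all radius-free) → `K̄, μ, κ_C⋆` → `R₁ := α(4K̄+4)∕θ₀ + α + 1` → `L := log((4K̄+4)∕θ₀)∕(μ∕4 − κ_C⋆)`, `T := 8K̄_P(c_V₀ + c_V)∕M`,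
`R_σ := max(T, L)` → `R := T·R₁ + R₁ + 1`» closes (B′)'s conjuncts AND the two exchange thresholds at ONE package, with the NODE-A
block still inhabited at it (same damped model; the torus must now carry an `R_σ = max(T, L)`-far collinear triple — circles of size
`≥ 4⌈R_σ⌉` do).  `θ₀` is left free ON PURPOSE: the (2.24)–(2.26) numerics fix it (`B13Bound226Numerals.theta0Max`, p583431, seat w1)
and are NOT re-witnessed here — instantiate `θ₀ := theta0Max …` by name downstream.
* §1 `nodeAPackage₁` (η installed, radii dummies), `kbarX ∕ masterX ∕ kapCX` (the package's `K̄, μ, κ_C⋆`), `farLX` (= `L`), `r1X` (= `R₁`),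
  ★ `nodeAPackageX dm κ₁ M α θ₀`.
* §2 `rfl` bookkeeping: `nodeAPackageX_fields`, `nodeAPackageX_cV`, ★ `derived_nodeAPackageX_indep` (`Kbar ∕ mu ∕ kapCStar ∕ etaMax` of
  `(nodeAPackageX …).toWalkPackage R₁` are `kbarX ∕ masterX ∕ kapCX ∕ etaNodeA` for EVERY `R₁`).
* §3 `kbarX_nonneg`, `r1X_pos`, `le_r1X` (`α < R₁`), ★ `alpha_small_nodeAPackageX` (hαsmall), ★ `rsigma_large_nodeAPackageX`
  (hRσlarge), `admissible_nodeAPackageX`, `positiveRates_nodeAPackageX`, ★ `thresholds_nodeAPackageX` (hPσ hP₁ hAσ hA₁ at `R_σ = max(T,L)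
  ≥ T`, `R = T·R₁ + R₁ + 1`).
* §4 ★★ `entrywiseBlockRungExchange_joint_nonvacuous` — (B′)'s ∃-package with `rf = nodeAPackageX dm κ₁ M α θ₀`, `R₁ = r1X …`, the
  round letters AT `K_G := K̄`, `K_Cs := 8∕m_{A,0}`, PLUS `0 < θ₀ ∧ hαsmall ∧ hRσlarge` in the junction's binder text, and the NODE-A
  block at `rf` on every admissible torus ∕ triple; ★ `entrywiseBlockRungExchange_joint_nonvacuous_circle` (actual circle data).
WHAT THIS DOES NOT DO (HONEST LABEL «NODE-A block + reference rung + the two exchange thresholds, θ₀ free»).  NOT in scope: the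
(2.24)–(2.26) numerics `hkap'' hk1–hk4 hθ₀le hθR1le hsmallKθ hc0 hcE hαc hsmall` and the choice of `θ₀` (w1's `B13Bound226Numerals` ∕
(A′)), `hPa`, `hvol`, the Lemma 1–2 located inputs, def-B13's `hKA2 hKG2 hKloc`; a single inhabitant of all ≈ 160 binders of form 32
is NOT claimed.  NOTHING of Bałaban's operators or constants is constructed or asserted; count-neutral Track-A side landing; NOT a
discharge of N10; no node count moves; one finite four-torus programme at fixed ε per run; nothing continuum ∕ ℝ⁴ ∕ OS ∕ mass-gap ∕ Clay.
CITATIONS.  [Balaban1988RG2Cluster] (1.11) p. 5, p. 13 («dist(X, Z₀) > ⅔M»), p. 15 («a bigger analyticity space … α′₀, α′₁»; «For the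
pair (U, 0) the operators are symmetric»; «The general case is handled by a perturbative argument»), (2.14)–(2.16) pp. 15–16;
[Balaban1985BackgroundPropagators] Thm 3.10 (3.107)–(3.108) p. 416, Thm 3.12 p. 423; [Balaban1984PropagatorsII] (2.46) p. 231,
Lemma 2.1 (2.61) p. 234.
0 `sorry`; bookkeeping `def`s with bodies only (`nodeAPackage₁`, `kbarX`, `masterX`, `kapCX`, `farLX`, `r1X`, `nodeAPackageX`), no instance,
no notation, no axiom; standard axioms.
-/

noncomputable section

namespace Literature.MathematicalPhysics.QuantumFieldTheory.Balaban1983to89.B13EntrywiseBlockRungExchangeWitness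

open Metric Set Finset
open scoped Matrix
open Literature.MathematicalPhysics.QuantumFieldTheory.Balaban1983to89
open Literature.MathematicalPhysics.QuantumFieldTheory.Balaban1983to89.B9Thm37GlueTorus (tdist1 tdist1_nonneg tdist1_comm tdist1_self)
open Literature.MathematicalPhysics.QuantumFieldTheory.Balaban1983to89.TreeLengthTorus (TPt)
open Literature.MathematicalPhysics.QuantumFieldTheory.Balaban1983to89.B5TorusCover (UT)
open Literature.MathematicalPhysics.QuantumFieldTheory.Balaban1983to89.B13Eq111SDecoupling (sDecorate)
open Literature.MathematicalPhysics.QuantumFieldTheory.Balaban1983to89.B13EntrywiseWalks (RawEntryLetters GeodesicDecoration rawEntryTerm)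
open Literature.MathematicalPhysics.QuantumFieldTheory.Balaban1983to89.NodeOLettersOfWalksAcross (WalkPackage)
open Literature.MathematicalPhysics.QuantumFieldTheory.Balaban1983to89.NodeOLettersOfWalksPerturbative (RefPackage)
open Literature.MathematicalPhysics.QuantumFieldTheory.Balaban1983to89.B13EntrywiseBlockWitness
  (loc2 deco kbarModel deco_inl_inr geodesicDecoration_deco ne_of_collinear fiber_loc2_le_one abs_one_apply_le one_apply_range
    far_loc2)
open Literature.MathematicalPhysics.QuantumFieldTheory.Balaban1983to89.B13EntrywiseBlockRungWitness
  (fluctR condOpR kbarNodeA nodeAPackage₀ etaNodeA tNodeA rawEntryLetters_fluctR condOpR_eq condOpR_accretive condOpR_inl_inr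
    fluctR_not_symm kbarModel_le_kbarNodeA kbarNodeA_nonneg etaNodeA_pos_le tNodeA_pos exists_collinear_triple_circle)

variable {ν : ℕ} {Nf : Fin ν → ℕ} [∀ i, NeZero (Nf i)]
variable {d N' : ℕ}

/-! ## §1. The package with the two exchange thresholds built in -/

/-- MODEL bookkeeping.  (B′)'s package with `η := etaMax` installed and the radii still dummies — the stage at which the
RADIUS-FREE derived constants `K̄, μ, κ_C⋆` are read. [cite: Balaban1988RG2Cluster, p.15, (2.16) p.16] -/
def nodeAPackage₁ (dm : ℕ) (κ₁ M : ℝ) : RefPackage :=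
  { nodeAPackage₀ dm κ₁ M with η := etaNodeA dm κ₁ M }

/-- MODEL bookkeeping.  The package's exchange constant `K̄ = max(3B_Γ + B′_Γ, 5K̄_A)` (radius-free). [cite: Balaban1988RG2Cluster, p.15] -/
def kbarX (dm : ℕ) (κ₁ M : ℝ) : ℝ := ((nodeAPackage₁ dm κ₁ M).toWalkPackage 1).Kbar

/-- MODEL bookkeeping.  The package's master rate `μ` (radius-free). [cite: Balaban1988RG2Cluster, (2.16) p.16] -/
def masterX (dm : ℕ) (κ₁ M : ℝ) : ℝ := ((nodeAPackage₁ dm κ₁ M).toWalkPackage 1).mu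

/-- MODEL bookkeeping.  The package's covariance rate `κ_C⋆` (radius-free). [cite: Balaban1988RG2Cluster, (2.16) p.16] -/
def kapCX (dm : ℕ) (κ₁ M : ℝ) : ℝ := ((nodeAPackage₁ dm κ₁ M).toWalkPackage 1).kapCStar

/-- MODEL bookkeeping.  PRINT's FAR-NESS THRESHOLD `L = log((4K̄ + 4)∕θ₀)∕(μ∕4 − κ_C⋆)` — the right-hand side of `hRσlarge`.
[cite: Balaban1988RG2Cluster, (1.11) p.5, p.13 («dist(X, Z₀) > ⅔M»)] -/
def farLX (dm : ℕ) (κ₁ M θ₀ : ℝ) : ℝ := Real.log ((4 * kbarX dm κ₁ M + 4) / θ₀) / (masterX dm κ₁ M / 4 - kapCX dm κ₁ M)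

/-- MODEL bookkeeping.  THE ACCRETIVITY RADIUS `R₁ = α(4K̄ + 4)∕θ₀ + α + 1` — large against the configuration size `α` at the
exchange letter `θ₀` (the «bigger analyticity space» of p. 15). [cite: Balaban1988RG2Cluster, p.15] -/
def r1X (dm : ℕ) (κ₁ M α θ₀ : ℝ) : ℝ := α * (4 * kbarX dm κ₁ M + 4) / θ₀ + α + 1

/-- MODEL bookkeeping.  ★ THE REFERENCE PACKAGE WITH THE EXCHANGE THRESHOLDS: `nodeAPackage₀` with `η := etaMax`,
`R_σ := max(T, L)`, `R := T·R₁ + R₁ + 1` at `R₁ = r1X`. [cite: Balaban1988RG2Cluster, p.15, (2.16) p.16] -/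
def nodeAPackageX (dm : ℕ) (κ₁ M α θ₀ : ℝ) : RefPackage :=
  { nodeAPackage₀ dm κ₁ M with
    R := tNodeA dm κ₁ M * r1X dm κ₁ M α θ₀ + r1X dm κ₁ M α θ₀ + 1
    η := etaNodeA dm κ₁ M
    Rσ := max (tNodeA dm κ₁ M) (farLX dm κ₁ M θ₀) }

/-! ## §2. `rfl` bookkeeping: fields; the derived constants do not read the radii -/

section Fields

variable (dm : ℕ) (κ₁ M α θ₀ : ℝ)

/-- Field bookkeeping (`rfl`). [cite: Balaban1988RG2Cluster, (2.16) p.16] -/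
theorem nodeAPackageX_fields :
    (nodeAPackageX dm κ₁ M α θ₀).R = tNodeA dm κ₁ M * r1X dm κ₁ M α θ₀ + r1X dm κ₁ M α θ₀ + 1 ∧
      (nodeAPackageX dm κ₁ M α θ₀).εL = 1 ∧ (nodeAPackageX dm κ₁ M α θ₀).kapL = 1 ∧
      (nodeAPackageX dm κ₁ M α θ₀).KbarL = kbarNodeA dm κ₁ M ∧ (nodeAPackageX dm κ₁ M α θ₀).εP = 1 ∧
      (nodeAPackageX dm κ₁ M α θ₀).kapP = 1 ∧ (nodeAPackageX dm κ₁ M α θ₀).KbarP = kbarNodeA dm κ₁ M ∧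
      (nodeAPackageX dm κ₁ M α θ₀).m₀ = M ∧ (nodeAPackageX dm κ₁ M α θ₀).εA = 1 ∧ (nodeAPackageX dm κ₁ M α θ₀).kapA = 1 ∧
      (nodeAPackageX dm κ₁ M α θ₀).KbarA = kbarNodeA dm κ₁ M ∧ (nodeAPackageX dm κ₁ M α θ₀).mA₀ = M ∧
      (nodeAPackageX dm κ₁ M α θ₀).η = etaNodeA dm κ₁ M ∧
      (nodeAPackageX dm κ₁ M α θ₀).Rσ = max (tNodeA dm κ₁ M) (farLX dm κ₁ M θ₀) ∧
      (nodeAPackageX dm κ₁ M α θ₀).nB = 1 ∧ (nodeAPackageX dm κ₁ M α θ₀).dm = dm :=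
  ⟨rfl, rfl, rfl, rfl, rfl, rfl, rfl, rfl, rfl, rfl, rfl, rfl, rfl, rfl, rfl, rfl⟩

/-- The volume constants (`rfl`). [cite: Balaban1984PropagatorsII, Lemma 2.1 (2.61) p.234] -/
theorem nodeAPackageX_cV :
    (nodeAPackageX dm κ₁ M α θ₀).cV₀ = ((1 : ℕ) : ℝ) * B6.c0 1 ((1 : ℝ) / 2) ^ dm ∧
      (nodeAPackageX dm κ₁ M α θ₀).cV = ((1 : ℕ) : ℝ) * B6.c0 1 (etaNodeA dm κ₁ M) ^ dm :=
  ⟨rfl, rfl⟩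

/-- ★ **THE DERIVED CONSTANTS DO NOT READ THE RADII** (`rfl`): for EVERY `R₁`, the W-walks package of `nodeAPackageX` has
`Kbar = K̄`, `mu = μ`, `kapCStar = κ_C⋆`, `etaMax = η` — the non-circularity behind «constants first, THEN `R₁`, THEN `R_σ`, THEN
`R`». [cite: Balaban1988RG2Cluster, p.15, (2.16) p.16] -/
theorem derived_nodeAPackageX_indep (R₁ : ℝ) :
    ((nodeAPackageX dm κ₁ M α θ₀).toWalkPackage R₁).Kbar = kbarX dm κ₁ M ∧
      ((nodeAPackageX dm κ₁ M α θ₀).toWalkPackage R₁).mu = masterX dm κ₁ M ∧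
      ((nodeAPackageX dm κ₁ M α θ₀).toWalkPackage R₁).kapCStar = kapCX dm κ₁ M ∧
      ((nodeAPackageX dm κ₁ M α θ₀).toWalkPackage R₁).etaMax = etaNodeA dm κ₁ M :=
  ⟨rfl, rfl, rfl, rfl⟩

end Fields

/-! ## §3. The exchange thresholds, admissibility, the perturbative thresholds -/

section Package

variable {dm : ℕ} {κ₁ M α θ₀ : ℝ}

/-- The η-installed package is admissible (`M > 0`). [cite: Balaban1988RG2Cluster, p.15] -/
theorem admissible_nodeAPackage₁ (hM : 0 < M) : (nodeAPackage₁ dm κ₁ M).Admissible where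
  hR := one_pos
  hεL := zero_le_one
  hkapL := zero_le_one
  hKbarL := kbarNodeA_nonneg dm κ₁ M hM.le
  hεP := zero_le_one
  hkapP := one_pos
  hKbarP := kbarNodeA_nonneg dm κ₁ M hM.le
  hm₀ := hM
  hεA := zero_le_one
  hkapA := one_pos
  hKbarA := kbarNodeA_nonneg dm κ₁ M hM.le
  hmA₀ := hM
  hη := (etaNodeA_pos_le (dm := dm) (κ₁ := κ₁) hM).1
  hηA := (etaNodeA_pos_le (dm := dm) (κ₁ := κ₁) hM).2

/-- `K̄ ≥ 0`. [cite: Balaban1988RG2Cluster, p.15] -/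
theorem kbarX_nonneg (hM : 0 < M) : 0 ≤ kbarX dm κ₁ M :=
  WalkPackage.Kbar_nonneg (RefPackage.admissible_toWalkPackage (admissible_nodeAPackage₁ (dm := dm) (κ₁ := κ₁) hM) one_pos)

/-- `R₁ > 0` and `α < R₁` (`α ≥ 0`, `θ₀ > 0`). [cite: Balaban1988RG2Cluster, p.15] -/
theorem r1X_pos_lt (hM : 0 < M) (hα : 0 ≤ α) (hθ₀ : 0 < θ₀) : 0 < r1X dm κ₁ M α θ₀ ∧ α < r1X dm κ₁ M α θ₀ := by
  have hK := kbarX_nonneg (dm := dm) (κ₁ := κ₁) hM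
  have h1 : 0 ≤ α * (4 * kbarX dm κ₁ M + 4) / θ₀ := by positivity
  unfold r1X
  constructor <;> linarith

/-- ★ **hαsmall — THE CONFIGURATION SIZE IS SMALL AGAINST THE ACCRETIVITY RADIUS**: `α ≤ θ₀·R₁∕(4K̄ + 4)` at `R₁ = α(4K̄+4)∕θ₀ + α + 1`
(indeed `θ₀R₁∕(4K̄+4) = α + θ₀(α+1)∕(4K̄+4) ≥ α`). [cite: Balaban1988RG2Cluster, p.15 («a bigger analyticity space»)] -/
theorem alpha_small_nodeAPackageX (hM : 0 < M) (hα : 0 ≤ α) (hθ₀ : 0 < θ₀) :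
    α ≤ θ₀ * r1X dm κ₁ M α θ₀ / (4 * ((nodeAPackageX dm κ₁ M α θ₀).toWalkPackage (r1X dm κ₁ M α θ₀)).Kbar + 4) := by
  rw [(derived_nodeAPackageX_indep dm κ₁ M α θ₀ _).1]
  have hK := kbarX_nonneg (dm := dm) (κ₁ := κ₁) hM
  have hD : 0 < 4 * kbarX dm κ₁ M + 4 := by linarith
  rw [le_div_iff₀ hD]
  unfold r1X
  have e : θ₀ * (α * (4 * kbarX dm κ₁ M + 4) / θ₀ + α + 1) = α * (4 * kbarX dm κ₁ M + 4) + θ₀ * (α + 1) := by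
    field_simp
    ring
  rw [e]
  nlinarith

/-- ★ **hRσlarge — THE σ-REGION IS FAR**: `log((4K̄+4)∕θ₀)∕(μ∕4 − κ_C⋆) ≤ R_σ = max(T, L)`.
[cite: Balaban1988RG2Cluster, (1.11) p.5, p.13 («dist(X, Z₀) > ⅔M»)] -/
theorem rsigma_large_nodeAPackageX (R₁ : ℝ) :
    Real.log ((4 * ((nodeAPackageX dm κ₁ M α θ₀).toWalkPackage R₁).Kbar + 4) / θ₀)
        / (((nodeAPackageX dm κ₁ M α θ₀).toWalkPackage R₁).mu / 4 - ((nodeAPackageX dm κ₁ M α θ₀).toWalkPackage R₁).kapCStar)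
      ≤ (nodeAPackageX dm κ₁ M α θ₀).Rσ := by
  obtain ⟨hK, hμ, hκ, -⟩ := derived_nodeAPackageX_indep dm κ₁ M α θ₀ R₁
  rw [hK, hμ, hκ, (nodeAPackageX_fields dm κ₁ M α θ₀).2.2.2.2.2.2.2.2.2.2.2.2.2.1]
  exact le_max_right _ _

/-- ★ **THE PACKAGE IS ADMISSIBLE** (`M > 0`, `α ≥ 0`, `θ₀ > 0`). [cite: Balaban1988RG2Cluster, p.15, (2.16) p.16] -/
theorem admissible_nodeAPackageX (hM : 0 < M) (hα : 0 ≤ α) (hθ₀ : 0 < θ₀) : (nodeAPackageX dm κ₁ M α θ₀).Admissible where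
  hR := by
    show 0 < tNodeA dm κ₁ M * r1X dm κ₁ M α θ₀ + r1X dm κ₁ M α θ₀ + 1
    have := tNodeA_pos (dm := dm) (κ₁ := κ₁) hM
    have := (r1X_pos_lt (dm := dm) (κ₁ := κ₁) hM hα hθ₀).1
    positivity
  hεL := zero_le_one
  hkapL := zero_le_one
  hKbarL := kbarNodeA_nonneg dm κ₁ M hM.le
  hεP := zero_le_one
  hkapP := one_pos
  hKbarP := kbarNodeA_nonneg dm κ₁ M hM.le
  hm₀ := hM
  hεA := zero_le_one
  hkapA := one_pos
  hKbarA := kbarNodeA_nonneg dm κ₁ M hM.le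
  hmA₀ := hM
  hη := (etaNodeA_pos_le (dm := dm) (κ₁ := κ₁) hM).1
  hηA := (etaNodeA_pos_le (dm := dm) (κ₁ := κ₁) hM).2

/-- hp — positive input rates on any radius. [cite: Balaban1988RG2Cluster, (2.16) p.16] -/
theorem positiveRates_nodeAPackageX (R₁ : ℝ) : ((nodeAPackageX dm κ₁ M α θ₀).toWalkPackage R₁).PositiveRates :=
  ⟨one_pos, one_pos, one_pos, one_pos, one_pos⟩

/-- ★ **THE FOUR PERTURBATIVE THRESHOLDS AT `R_σ = max(T, L) ≥ T`, `R = T·R₁ + R₁ + 1`**: `hPσ`, `hP₁`, `hAσ`, `hA₁`.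
[cite: Balaban1988RG2Cluster, p.15 («O(1)e^{−⅓δ₀M} + O(α₀ + α₁)»), (2.16) p.16] -/
theorem thresholds_nodeAPackageX (hM : 0 < M) (hα : 0 ≤ α) (hθ₀ : 0 < θ₀) :
    8 * (nodeAPackageX dm κ₁ M α θ₀).KbarP * (nodeAPackageX dm κ₁ M α θ₀).cV₀ *
          Real.exp (-((nodeAPackageX dm κ₁ M α θ₀).εP * (nodeAPackageX dm κ₁ M α θ₀).Rσ)) ≤ (nodeAPackageX dm κ₁ M α θ₀).m₀ ∧
      8 * (nodeAPackageX dm κ₁ M α θ₀).KbarP * (nodeAPackageX dm κ₁ M α θ₀).cV₀ * r1X dm κ₁ M α θ₀ ≤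
          (nodeAPackageX dm κ₁ M α θ₀).m₀ * (nodeAPackageX dm κ₁ M α θ₀).R ∧
      8 * (nodeAPackageX dm κ₁ M α θ₀).KbarA * (nodeAPackageX dm κ₁ M α θ₀).cV *
          Real.exp (-((nodeAPackageX dm κ₁ M α θ₀).εA * (nodeAPackageX dm κ₁ M α θ₀).Rσ)) ≤ (nodeAPackageX dm κ₁ M α θ₀).mA₀ ∧
      8 * (nodeAPackageX dm κ₁ M α θ₀).KbarA * (nodeAPackageX dm κ₁ M α θ₀).cV * r1X dm κ₁ M α θ₀ ≤
          (nodeAPackageX dm κ₁ M α θ₀).mA₀ * (nodeAPackageX dm κ₁ M α θ₀).R := by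
  obtain ⟨hR, -, -, -, hεP, -, hKP, hm₀, hεA, -, hKA, hmA, -, hRσ, -, -⟩ := nodeAPackageX_fields dm κ₁ M α θ₀
  obtain ⟨hcV₀, hcV⟩ := nodeAPackageX_cV dm κ₁ M α θ₀
  rw [hR, hεP, hKP, hm₀, hεA, hKA, hmA, hRσ, hcV₀, hcV, one_mul]
  set K := kbarNodeA dm κ₁ M with hKdef
  set c₀ : ℝ := ((1 : ℕ) : ℝ) * B6.c0 1 ((1 : ℝ) / 2) ^ dm with hc₀def
  set c₁ : ℝ := ((1 : ℕ) : ℝ) * B6.c0 1 (etaNodeA dm κ₁ M) ^ dm with hc₁def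
  set T := tNodeA dm κ₁ M with hTdef
  set L := farLX dm κ₁ M θ₀ with hLdef
  set R₁ := r1X dm κ₁ M α θ₀ with hR₁def
  have hR₁ : 0 < R₁ := (r1X_pos_lt (dm := dm) (κ₁ := κ₁) hM hα hθ₀).1
  have hK0 : 0 ≤ K := kbarNodeA_nonneg dm κ₁ M hM.le
  have hc₀0 : 0 ≤ c₀ := by
    rw [hc₀def, Nat.cast_one, one_mul]; exact pow_nonneg (B6RandomWalk.c0_nonneg 1 _) dm
  have hc₁0 : 0 ≤ c₁ := by
    rw [hc₁def, Nat.cast_one, one_mul]; exact pow_nonneg (B6RandomWalk.c0_nonneg 1 _) dm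
  have hT : T = 8 * K * (c₀ + c₁) / M := rfl
  have hTM : T * M = 8 * K * (c₀ + c₁) := by rw [hT]; field_simp
  -- `max(T,L)·e^{−max(T,L)}`-free form: `e^{−max(T,L)} ≤ e^{−T}` and `T·e^{−T} ≤ 1`
  have hexpT : T * Real.exp (-T) ≤ 1 := by
    have h1 : T + 1 ≤ Real.exp T := Real.add_one_le_exp T
    have h2 : Real.exp T * Real.exp (-T) = 1 := by rw [← Real.exp_add, add_neg_cancel, Real.exp_zero]
    have h3 : 0 ≤ Real.exp (-T) := Real.exp_nonneg _
    nlinarith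
  have hmono : Real.exp (-max T L) ≤ Real.exp (-T) := Real.exp_le_exp.2 (neg_le_neg (le_max_left _ _))
  have hσ : ∀ c : ℝ, 0 ≤ c → c ≤ c₀ + c₁ → 8 * K * c * Real.exp (-max T L) ≤ M := by
    intro c hc hcle
    have h1 : 8 * K * c ≤ T * M := by rw [hTM]; gcongr
    have h8 : 0 ≤ 8 * K * c := by positivity
    calc 8 * K * c * Real.exp (-max T L) ≤ 8 * K * c * Real.exp (-T) := mul_le_mul_of_nonneg_left hmono h8
      _ ≤ T * M * Real.exp (-T) := mul_le_mul_of_nonneg_right h1 (Real.exp_nonneg _)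
      _ = M * (T * Real.exp (-T)) := by ring
      _ ≤ M * 1 := mul_le_mul_of_nonneg_left hexpT hM.le
      _ = M := mul_one M
  have h1' : ∀ c : ℝ, 0 ≤ c → c ≤ c₀ + c₁ → 8 * K * c * R₁ ≤ M * (T * R₁ + R₁ + 1) := by
    intro c hc hcle
    have h1 : 8 * K * c ≤ T * M := by rw [hTM]; gcongr
    calc 8 * K * c * R₁ ≤ T * M * R₁ := mul_le_mul_of_nonneg_right h1 hR₁.le
      _ = M * (T * R₁) := by ring
      _ ≤ M * (T * R₁ + R₁ + 1) := by gcongr; linarith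
  exact ⟨hσ c₀ hc₀0 (le_add_of_nonneg_right hc₁0), h1' c₀ hc₀0 (le_add_of_nonneg_right hc₁0),
    hσ c₁ hc₁0 (le_add_of_nonneg_left hc₀0), h1' c₁ hc₁0 (le_add_of_nonneg_left hc₀0)⟩

end Package

/-! ## §4. ★★ The joint witness: NODE-A block, reference rung and the two exchange thresholds at ONE package -/

section Joint

/-- ★★ **NODE-A BLOCK + REFERENCE RUNG + THE TWO EXCHANGE THRESHOLDS, JOINTLY, AT ONE ADMISSIBLE PACKAGE, FOR EVERY `θ₀ > 0`.**
For every dimension bound `d_m`, polydisc exponent `κ₁ ≥ 0` (= `cp.κ₁`), mass `M > 0`, configuration size `α ≥ 0` and exchange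
letter `θ₀ > 0`: with `rf := nodeAPackageX d_m κ₁ M α θ₀`, `R₁ := r1X d_m κ₁ M α θ₀`, `K_G := (rf.toWalkPackage R₁).Kbar`,
`K_Cs := 8∕rf.mA₀` — the binders `hrf hR₁ hR₁R hPσ hP₁ hAσ hA₁ hp hη hαR hεL hκL hKL hεA hκA hKA hmA hKG hKCs hθ₀ hαsmall hRσlarge` of
`…N10AtRecord11B13WalksBlockEntrywise.b13LeafOfRecord_of_located_entrywise` (:218–221, :272–278) hold, AND for every site torus with
`hKdim : ν ≤ rf.dm`, every cube index and every `d₁`-collinear triple with gaps `≥ rf.Rσ` the entrywise NODE-A block (`hKX … hKmult`, read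
at `rf`'s fields and `κ₁`) is inhabited, genuinely.  `θ₀` is free: instantiate by `B13Bound226Numerals.theta0Max` downstream.
[cite: Balaban1988RG2Cluster, (1.11) p.5, p.13, p.15, (2.14)–(2.16) pp.15–16; Balaban1985BackgroundPropagators, Thm 3.10 (3.107)–(3.108) p.416, Thm 3.12 p.423] -/
theorem entrywiseBlockRungExchange_joint_nonvacuous (dm : ℕ) {κ₁ M α θ₀ : ℝ} (hκ₁ : 0 ≤ κ₁) (hM : 0 < M) (hα : 0 ≤ α)
    (hθ₀ : 0 < θ₀) :
    ∃ (rf : RefPackage) (R₁ KG KCs : ℝ), rf = nodeAPackageX dm κ₁ M α θ₀ ∧ R₁ = r1X dm κ₁ M α θ₀ ∧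
      KG = (rf.toWalkPackage R₁).Kbar ∧ KCs = 8 / rf.mA₀ ∧
      -- hrf hR₁ hR₁R
      rf.Admissible ∧ 0 < R₁ ∧ R₁ < rf.R ∧
      -- hPσ hP₁ hAσ hA₁
      8 * rf.KbarP * rf.cV₀ * Real.exp (-(rf.εP * rf.Rσ)) ≤ rf.m₀ ∧ 8 * rf.KbarP * rf.cV₀ * R₁ ≤ rf.m₀ * rf.R ∧
      8 * rf.KbarA * rf.cV * Real.exp (-(rf.εA * rf.Rσ)) ≤ rf.mA₀ ∧ 8 * rf.KbarA * rf.cV * R₁ ≤ rf.mA₀ * rf.R ∧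
      -- hp hη hαR
      (rf.toWalkPackage R₁).PositiveRates ∧ rf.η ≤ (rf.toWalkPackage R₁).etaMax ∧ α < R₁ ∧
      -- hεL hκL hKL hεA hκA hKA hmA
      rf.εL ≤ rf.εP ∧ rf.kapL ≤ rf.kapP ∧ rf.KbarP ≤ rf.KbarL ∧ rf.εA ≤ rf.εP ∧ rf.kapA ≤ rf.kapP ∧ rf.KbarP ≤ rf.KbarA ∧
        rf.mA₀ ≤ rf.m₀ ∧
      -- hKG hKCs hθ₀
      (rf.toWalkPackage R₁).Kbar ≤ KG ∧ 8 / rf.mA₀ ≤ KCs ∧ 0 < θ₀ ∧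
      -- hαsmall hRσlarge
      α ≤ θ₀ * R₁ / (4 * (rf.toWalkPackage R₁).Kbar + 4) ∧
      Real.log ((4 * (rf.toWalkPackage R₁).Kbar + 4) / θ₀)
        / ((rf.toWalkPackage R₁).mu / 4 - (rf.toWalkPackage R₁).kapCStar) ≤ rf.Rσ ∧
      -- the NODE-A block at this package (hKdim = the torus's `ν ≤ rf.dm`)
      (∀ {ν : ℕ} {Nf : Fin ν → ℕ} [∀ i, NeZero (Nf i)] {d N' : ℕ} (cube : TPt d N') {x₀ z x₁ : UT Nf},
        ν ≤ rf.dm → rf.Rσ ≤ tdist1 Nf x₀ z → rf.Rσ ≤ tdist1 Nf x₁ z →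
        tdist1 Nf x₀ z + tdist1 Nf z x₁ ≤ tdist1 Nf x₀ x₁ →
        ∃ (locF : Unit ⊕ Unit → UT Nf) (Δ₀ : ℂ → Matrix (Unit ⊕ Unit) (Unit ⊕ Unit) ℂ)
          (ρΔ BΔ εΔ κΔ ηΔ μΔ M₁ rC : ℝ) (mF c₀ : ℕ)
          (J : (Unit ⊕ Unit) × (Unit ⊕ Unit) → Finset (TPt d N'))
          (C : Matrix (Unit ⊕ Unit) (Unit ⊕ Unit) ℝ)
          (KK : (TPt d N' → ℂ) → ℂ → Matrix (Unit ⊕ Unit) (Unit ⊕ Unit) ℂ)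
          (X : Finset (UT Nf)) (locN : Unit ⊕ Unit → UT Nf),
          X.Nonempty ∧
          RawEntryLetters Δ₀ locF rf.R ρΔ BΔ ∧
          (∀ y : UT Nf, (Finset.univ.filter fun k => locF k = y).card ≤ mF) ∧
          GeodesicDecoration J locF X c₀ M₁ ∧
          0 < ηΔ ∧ ηΔ ≤ εΔ ∧ εΔ < ρΔ ∧ 2 * κ₁ ≤ ηΔ * M₁ ∧
          (∀ k i, |C k i| ≤ 1) ∧ (∀ k i, C k i ≠ 0 → tdist1 Nf (locF k) (locN i) ≤ rC) ∧
          0 < μΔ ∧ 2 * μΔ ≤ εΔ - ηΔ ∧ 2 * μΔ ≤ κΔ ∧ κΔ ≤ ρΔ - εΔ ∧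
          rf.εP ≤ εΔ - ηΔ - μΔ - μΔ ∧ rf.kapP ≤ κΔ - μΔ - μΔ ∧
          (mF * B6.c0 1 μΔ ^ ν) * ((mF * B6.c0 1 μΔ ^ ν) * Real.exp ((ρΔ - ηΔ) * rC) *
              (Real.exp (κ₁ * (2 * c₀ : ℕ)) * (BΔ * (mF * mF + 1))) * B6.c0 1 μΔ ^ ν) *
              Real.exp ((ρΔ - ηΔ - μΔ) * rC) * B6.c0 1 μΔ ^ ν ≤ rf.KbarP ∧
          (∀ σ u, KK σ u =
            ((C.map (algebraMap ℝ ℂ))ᵀ *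
              sDecorate (fun ω : ((Unit ⊕ Unit) × (Unit ⊕ Unit)) ⊕ ((Unit ⊕ Unit) × (Unit ⊕ Unit)) =>
                  J (Sum.elim id id ω))
                (fun ω u => Sum.elim (fun ω => (1 / 2 : ℂ) • rawEntryTerm Δ₀ ω u)
                  (fun ω => (1 / 2 : ℂ) • (rawEntryTerm Δ₀ ω u)ᵀ) ω) σ u *
              C.map (algebraMap ℝ ℂ))) ∧
          (∀ v : Unit ⊕ Unit → ℂ, rf.m₀ * ∑ i, ‖v i‖ ^ 2 ≤ (∑ i, star (v i) * (KK 0 0 *ᵥ v) i).re) ∧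
          (∀ k, ∀ z' ∈ X, rf.Rσ ≤ tdist1 Nf (locN k) z') ∧
          (∀ x : UT Nf, (Finset.univ.filter fun k => locN k = x).card ≤ rf.nB) ∧
          (∃ ω, (J ω).Nonempty) ∧
          (∀ σ u, KK σ u (Sum.inl ()) (Sum.inr ()) =
            σ cube * (((Real.exp (-(7 * tdist1 Nf x₀ x₁)) / rf.R : ℝ) : ℂ) * u / 2)) ∧
          (∀ u : ℂ, u ≠ 0 → Δ₀ u (Sum.inl ()) (Sum.inr ()) ≠ Δ₀ u (Sum.inr ()) (Sum.inl ()))) := by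
  obtain ⟨hR, hεL, hκL, hKL, hεP, hκP, hKP, hm₀, hεA, hκA, hKA, hmA, hη, hRσ, hnB, hdm⟩ := nodeAPackageX_fields dm κ₁ M α θ₀
  have hT := tNodeA_pos (dm := dm) (κ₁ := κ₁) hM
  have hth := thresholds_nodeAPackageX (dm := dm) (κ₁ := κ₁) hM hα hθ₀
  have hrf := admissible_nodeAPackageX (dm := dm) (κ₁ := κ₁) hM hα hθ₀
  obtain ⟨hR₁, hαR₁⟩ := r1X_pos_lt (dm := dm) (κ₁ := κ₁) hM hα hθ₀
  have hRσpos : 0 < (nodeAPackageX dm κ₁ M α θ₀).Rσ := by rw [hRσ]; exact lt_max_of_lt_left hT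
  refine ⟨nodeAPackageX dm κ₁ M α θ₀, r1X dm κ₁ M α θ₀,
    ((nodeAPackageX dm κ₁ M α θ₀).toWalkPackage (r1X dm κ₁ M α θ₀)).Kbar, 8 / (nodeAPackageX dm κ₁ M α θ₀).mA₀,
    rfl, rfl, rfl, rfl, hrf, hR₁, ?_, hth.1, hth.2.1, hth.2.2.1, hth.2.2.2, positiveRates_nodeAPackageX _, ?_, hαR₁,
    ?_, ?_, ?_, ?_, ?_, ?_, ?_, le_rfl, le_rfl, hθ₀, alpha_small_nodeAPackageX hM hα hθ₀, rsigma_large_nodeAPackageX _, ?_⟩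
  · rw [hR]; nlinarith
  · rw [(derived_nodeAPackageX_indep dm κ₁ M α θ₀ _).2.2.2, hη]
  · rw [hεL, hεP]
  · rw [hκL, hκP]
  · rw [hKL, hKP]
  · rw [hεA, hεP]
  · rw [hκA, hκP]
  · rw [hKA, hKP]
  · rw [hmA, hm₀]
  -- the NODE-A block at the package (as in (B′), with `R_σ = max(T, L)`)
  intro ν Nf _ d N' cube x₀ z x₁ hν h0 h1 hcol
  rw [hdm] at hν
  have hRpos : 0 < (nodeAPackageX dm κ₁ M α θ₀).R := hrf.hR
  have hne : x₀ ≠ x₁ := ne_of_collinear hRσpos h0 hcol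
  refine ⟨loc2 x₀ x₁, fluctR M (nodeAPackageX dm κ₁ M α θ₀).R (Real.exp (-(7 * tdist1 Nf x₀ x₁))), 7, M + 1, 4, 3, 1, 1,
    2 * κ₁ + 1, 0, 1, 1, deco x₀ x₁ z cube, 1, condOpR x₀ x₁ z cube M (nodeAPackageX dm κ₁ M α θ₀).R
      (Real.exp (-(7 * tdist1 Nf x₀ x₁))), {z}, loc2 x₀ x₁,
    Finset.singleton_nonempty z, rawEntryLetters_fluctR hM.le hRpos x₀ x₁, fun y => fiber_loc2_le_one hne y,
    geodesicDecoration_deco cube x₀ x₁ z (by linarith), one_pos, by norm_num, by norm_num, by nlinarith, abs_one_apply_le,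
    fun k i h => one_apply_range k i h, one_pos, by norm_num, by norm_num, by norm_num, ?_, ?_, ?_,
    fun σ u => condOpR_eq cube x₀ x₁ z M _ _ σ u, ?_, ?_, ?_, ⟨(Sum.inl (), Sum.inr ()), ?_⟩,
    fun σ u => condOpR_inl_inr cube hcol σ u () (), fun u hu => fluctR_not_symm hRpos (Real.exp_pos _) hu⟩
  · rw [hεP]; norm_num
  · rw [hκP]; norm_num
  · rw [hKP]
    exact (le_of_eq (by unfold kbarModel; rfl)).trans (kbarModel_le_kbarNodeA (κ₁ := κ₁) hM.le hν)
  · intro v; rw [hm₀]; exact condOpR_accretive cube hRσpos h0 h1 hcol v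
  · intro k; exact far_loc2 h0 h1 k
  · intro x; rw [hnB]; exact fiber_loc2_le_one hne x
  · rw [deco_inl_inr cube hcol]; exact Finset.singleton_nonempty _

/-- ★ **ACTUAL DATA ON A CIRCLE**: for `d_m ≥ 1` and every circle `ℤ∕nℤ` with `n ≥ 4⌈rf.R_σ⌉` (`rf = nodeAPackageX d_m κ₁ M α θ₀`) there is
a `d₁`-collinear triple `R_σ`-far, so the NODE-A block of `entrywiseBlockRungExchange_joint_nonvacuous` is inhabited by concrete sites
TOGETHER with the rung block and the two exchange thresholds. [cite: Balaban1988RG2Cluster, (1.11) p.5, p.13, p.15; Balaban1984PropagatorsII, (2.46) p.231] -/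
theorem entrywiseBlockRungExchange_joint_nonvacuous_circle (dm : ℕ) (hdm : 1 ≤ dm) {κ₁ M : ℝ} (α θ₀ : ℝ) (hM : 0 < M)
    (n : ℕ) [NeZero n] (hn : 4 * ⌈(nodeAPackageX dm κ₁ M α θ₀).Rσ⌉₊ ≤ n) :
    (1 : ℕ) ≤ (nodeAPackageX dm κ₁ M α θ₀).dm ∧
      ∃ x₀ z x₁ : UT (fun _ : Fin 1 => n),
        (nodeAPackageX dm κ₁ M α θ₀).Rσ ≤ tdist1 (fun _ : Fin 1 => n) x₀ z ∧
          (nodeAPackageX dm κ₁ M α θ₀).Rσ ≤ tdist1 (fun _ : Fin 1 => n) x₁ z ∧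
          tdist1 (fun _ : Fin 1 => n) x₀ z + tdist1 (fun _ : Fin 1 => n) z x₁ ≤ tdist1 (fun _ : Fin 1 => n) x₀ x₁ := by
  have hT := tNodeA_pos (dm := dm) (κ₁ := κ₁) hM
  have hRσ := (nodeAPackageX_fields dm κ₁ M α θ₀).2.2.2.2.2.2.2.2.2.2.2.2.2.1
  have hRσpos : 0 < (nodeAPackageX dm κ₁ M α θ₀).Rσ := by rw [hRσ]; exact lt_max_of_lt_left hT
  exact ⟨by rw [(nodeAPackageX_fields dm κ₁ M α θ₀).2.2.2.2.2.2.2.2.2.2.2.2.2.2.2]; exact hdm,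
    exists_collinear_triple_circle hRσpos n hn⟩

end Joint

end Literature.MathematicalPhysics.QuantumFieldTheory.Balaban1983to89.B13EntrywiseBlockRungExchangeWitness

end
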